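import Mathlib.GroupTheory.OrderOfElement
import Mathlib.GroupTheory.Perm.Basic
import Mathlib.GroupTheory.PresentedGroup
import Mathlib.Tactic.Group
import Mathlib.Algebra.BigOperators.Group.List.Basic
import Literature.GroupTheory.CombinatorialGroupTheory.PuncturedSurfaceGroupNodeLoopBasis
import HarnessLib

/-!
# Fibred translations of `Q × M`, orbit cocycles, and Heisenberg power commutators

Topic `Literature/GroupTheory/CombinatorialGroupTheory`; PROOF-ONLY (0 definitions: every object is produced
by an `∃`).  Elementary tools for building finite permutation actions of a finitely presented group `Γ` on
`Q × M` (`Q = Γ/N` a finite quotient, `M` a finite group) that COVER left translation on `Q` and multiply the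
fibre on the LEFT by a cocycle value — the discrete half of "gluing together appropriate finite étale coverings
of the anabelioids `G_v`, `G_e`" in the PROOF of [CombGC] Prop. 1.2, p. 9 (Mochizuki, *A combinatorial
version of the Grothendieck conjecture*, Tohoku Math. J. **59** (2007)) [cite: MochizukiCombGC2007, Prop 1.2 proof p.9],
for NON-ABELIAN `M` (the node of a two-component degeneration, whose loop `ε ∈ [Γ,Γ]` is invisible to every
character; consumer: `PuncturedSurfaceGroupNodeTwist.lean`, abc-iut row «NODE-RESIDUAL@UNMARKED»):

* `NodeTwist.exists_twistPerm`, `twist_inv_apply`, `twist_mul_apply`, `twist_comm_apply` — fibred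
  ("twisted") translations `(p, m) ↦ (u p, κ(p) m)` and the cocycle of a commutator of two of them;
* `NodeTwist.exists_orbitCocycle` — **the orbit cocycle**: on a finite group `Q`, for `v, p₀ ∈ Q` and
  `X, Y ∈ M`, a cocycle `α` with `α(v t) X α(t)⁻¹ X⁻¹ = [Y, X^{ord v}]` at the single point `t = v⁻¹ p₀` and
  `= 1` elsewhere (`α(v^k p₀) = X^k Y X^{−k}` along the `⟨v⟩`-orbit via the discrete logarithm
  `finEquivZPowers`, `1` off it) — the device producing a commutator cocycle with NONZERO net charge;
* `NodeTwist.pow_mul_pow_eq_of_comm_eq_central`, `pow_comm_pow_eq_of_comm_eq_central` — `X^t Y^s = Z^{st} Y^s X^t`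
  and `[Y^s, X^t] = Z^{−st}` when `X Y X⁻¹ Y⁻¹ = Z` is central;
* `NodeTwist.exists_plainPerm`, `NodeTwist.fibred_of_generators` — the plain translation action, and: an
  action of a presented group all of whose generators act by fibred translations acts by fibred translations;
* `NodeTwist.twist_pow_apply_of_forall_ne`, `twist_pow_apply_self` — powers of a fibred translation whose
  cocycle is `W` at one point `p₁` and `1` elsewhere: plain along orbits missing `p₁`, charge `W^e` at `p₁`;
* `prod_map_finRange_ite_eq`, `prod_map_finRange_lt_eq_first_mul`, `prod_map_finRange_eq_first_mul_mid_mul_last`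
  — peeling the first / last factor off an ordered `List.finRange` product (non-commutative).

Folklore group theory; nothing here bears on [IUTchIII] Cor. 3.12.
-/

namespace Literature.GroupTheory.CombinatorialGroupTheory

namespace NodeTwist

variable {Q M : Type*} [Group Q] [Group M]

/-- **Fibred ("twisted") translations of `Q × M`**: left translation by `u` on `Q`, left multiplication
by a cocycle value `κ p` on the fibre (the local model of a glued finite covering). [cite: MochizukiCombGC2007, Prop 1.2 proof p.9] -/
theorem exists_twistPerm (u : Q) (κ : Q → M) :
    ∃ σ : Equiv.Perm (Q × M), ∀ p m, σ (p, m) = (u * p, κ p * m) := by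
  refine ⟨⟨fun x => (u * x.1, κ x.1 * x.2), fun x => (u⁻¹ * x.1, (κ (u⁻¹ * x.1))⁻¹ * x.2), ?_, ?_⟩,
    fun p m => rfl⟩
  · rintro ⟨p, m⟩
    simp only [inv_mul_cancel_left]
  · rintro ⟨p, m⟩
    simp only [mul_inv_cancel_left]

/-- The inverse of a fibred translation is a fibred translation. [cite: MochizukiCombGC2007, Prop 1.2 proof p.9] -/
theorem twist_inv_apply {σ : Equiv.Perm (Q × M)} {u : Q} {κ : Q → M}
    (h : ∀ p m, σ (p, m) = (u * p, κ p * m)) (p : Q) (m : M) :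
    σ⁻¹ (p, m) = (u⁻¹ * p, (κ (u⁻¹ * p))⁻¹ * m) := by
  rw [Equiv.Perm.inv_def, Equiv.symm_apply_eq, h, mul_inv_cancel_left, mul_inv_cancel_left]

/-- The product of two fibred translations is a fibred translation. [cite: MochizukiCombGC2007, Prop 1.2 proof p.9] -/
theorem twist_mul_apply {σ σ' : Equiv.Perm (Q × M)} {u u' : Q} {κ κ' : Q → M}
    (h : ∀ p m, σ (p, m) = (u * p, κ p * m)) (h' : ∀ p m, σ' (p, m) = (u' * p, κ' p * m))
    (p : Q) (m : M) :
    (σ * σ') (p, m) = (u * (u' * p), κ (u' * p) * (κ' p * m)) := by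
  rw [Equiv.Perm.mul_apply, h', h]

/-- **The commutator of two fibred translations** with the second cocycle constant `= X`:
`[σ_a, σ_b](p, m) = ([u,v]·p, α(v u⁻¹ v⁻¹ p) · X · α(u⁻¹ v⁻¹ p)⁻¹ · X⁻¹ · m)`. [cite: MochizukiCombGC2007, Prop 1.2 proof p.9] -/
theorem twist_comm_apply {σa σb : Equiv.Perm (Q × M)} {u v : Q} {α : Q → M} {X : M}
    (ha : ∀ p m, σa (p, m) = (u * p, α p * m)) (hb : ∀ p m, σb (p, m) = (v * p, X * m))
    (p : Q) (m : M) :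
    (σa * σb * σa⁻¹ * σb⁻¹) (p, m) =
      (u * v * u⁻¹ * v⁻¹ * p, α (v * (u⁻¹ * (v⁻¹ * p))) * X * (α (u⁻¹ * (v⁻¹ * p)))⁻¹ * X⁻¹ * m) := by
  rw [Equiv.Perm.mul_apply, Equiv.Perm.mul_apply, Equiv.Perm.mul_apply,
    twist_inv_apply hb, twist_inv_apply ha, hb, ha]
  simp only [mul_assoc]

omit [Group M] in
/-- **The plain translation action** of `G` on `Q × M` through `π : G → Q` (the trivial covering). [cite: MochizukiCombGC2007, Prop 1.2 proof p.9] -/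
theorem exists_plainPerm {G : Type*} [Group G] (π : G →* Q) :
    ∃ pl : G →* Equiv.Perm (Q × M), ∀ y p m, pl y (p, m) = (π y * p, m) :=
  ⟨{ toFun := fun y => (Equiv.mulLeft (π y)).prodCongr (Equiv.refl M)
     map_one' := Equiv.ext fun z => by
       change (π 1 * z.1, z.2) = z
       rw [map_one, one_mul]
     map_mul' := fun y y' => Equiv.ext fun z => by
       change (π (y * y') * z.1, z.2) = (π y * (π y' * z.1), z.2)
       rw [map_mul, mul_assoc] }, fun _ _ _ => rfl⟩

/-- **Fibred on generators ⟹ fibred**: if every generator of a presented group acts on `Q × M` by a fibred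
translation over its image under `π`, so does every element. [cite: MochizukiCombGC2007, Prop 1.2 proof p.9] -/
theorem fibred_of_generators {ι : Type*} {rels : Set (FreeGroup ι)}
    (ρ : PresentedGroup rels →* Equiv.Perm (Q × M)) (π : PresentedGroup rels →* Q)
    (hgen : ∀ s, ∃ κ : Q → M, ∀ p m,
      ρ (PresentedGroup.of s) (p, m) = (π (PresentedGroup.of s) * p, κ p * m))
    (γ : PresentedGroup rels) : ∃ κ : Q → M, ∀ p m, ρ γ (p, m) = (π γ * p, κ p * m) := by
  induction γ using PresentedGroup.induction_on with
  | H z =>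
    induction z using FreeGroup.induction_on with
    | C1 => exact ⟨fun _ => 1, fun p m₀ => by
        rw [map_one, map_one, Equiv.Perm.one_apply, map_one, one_mul, one_mul]⟩
    | of s => exact hgen s
    | inv_of s _ =>
      change ∃ κ : Q → M, ∀ p m₀,
        ρ (PresentedGroup.of s)⁻¹ (p, m₀) = (π (PresentedGroup.of s)⁻¹ * p, κ p * m₀)
      rw [map_inv, map_inv]
      obtain ⟨κ, hκ⟩ := hgen s
      exact ⟨fun p => (κ ((π (PresentedGroup.of s))⁻¹ * p))⁻¹, twist_inv_apply hκ⟩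
    | mul y y' ihy ihy' =>
      obtain ⟨κ₁, h₁⟩ := ihy
      obtain ⟨κ₂, h₂⟩ := ihy'
      refine ⟨fun p => κ₁ (π (PresentedGroup.mk _ y') * p) * κ₂ p, fun p m₀ => ?_⟩
      rw [map_mul, map_mul ρ, twist_mul_apply h₁ h₂, map_mul π, mul_assoc, mul_assoc]


/-- **Powers of a `δ`-twist off the support**: if `σ(p, m) = (y p, W^{[p = p₁]} m)` and the `⟨y⟩`-orbit of
`p` misses `p₁`, then `σ^j (p, m) = (y^j p, m)`. [cite: MochizukiCombGC2007, Prop 1.2 proof p.9] -/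
theorem twist_pow_apply_of_forall_ne [DecidableEq Q] {σ : Equiv.Perm (Q × M)} {y p₁ : Q} {W : M}
    (h : ∀ p m, σ (p, m) = (y * p, (if p = p₁ then W else 1) * m)) (p : Q)
    (hp : ∀ i : ℕ, y ^ i * p ≠ p₁) (j : ℕ) (m : M) : (σ ^ j) (p, m) = (y ^ j * p, m) := by
  induction j generalizing m with
  | zero => rw [pow_zero, pow_zero, Equiv.Perm.one_apply, one_mul]
  | succ j ih =>
    rw [pow_succ', Equiv.Perm.mul_apply, ih, h, if_neg (hp j), one_mul, ← mul_assoc, ← pow_succ']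

/-- **Powers of a `δ`-twist at the support**: `σ^j (p₁, m) = (y^j p₁, W^e m)` with `1 ≤ e ≤ j` for `j ≥ 1`
(`e` = the number of returns of the `⟨y⟩`-orbit to `p₁` before time `j`). [cite: MochizukiCombGC2007, Prop 1.2 proof p.9] -/
theorem twist_pow_apply_self [DecidableEq Q] {σ : Equiv.Perm (Q × M)} {y p₁ : Q} {W : M}
    (h : ∀ p m, σ (p, m) = (y * p, (if p = p₁ then W else 1) * m)) (j : ℕ) :
    ∃ e : ℕ, (1 ≤ j → 1 ≤ e) ∧ e ≤ j ∧ ∀ m : M, (σ ^ j) (p₁, m) = (y ^ j * p₁, W ^ e * m) := by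
  induction j with
  | zero => exact ⟨0, fun h0 => absurd h0 (by omega), le_rfl, fun m₀ => by
      rw [pow_zero, pow_zero, pow_zero, Equiv.Perm.one_apply, one_mul, one_mul]⟩
  | succ j ih =>
    obtain ⟨e, he1, he2, he⟩ := ih
    by_cases hfix : y ^ j * p₁ = p₁
    · refine ⟨e + 1, fun _ => by omega, by omega, fun m₀ => ?_⟩
      rw [pow_succ', Equiv.Perm.mul_apply, he, h, if_pos hfix, ← mul_assoc, ← pow_succ', ← mul_assoc,
        ← pow_succ']
    · have hj : 1 ≤ j := by
        rcases Nat.eq_zero_or_pos j with rfl | hj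
        · exact absurd (by rw [pow_zero, one_mul]) hfix
        · exact hj
      refine ⟨e, fun _ => he1 hj, by omega, fun m₀ => ?_⟩
      rw [pow_succ', Equiv.Perm.mul_apply, he, h, if_neg hfix, one_mul, ← mul_assoc, ← pow_succ']

/-- **The orbit cocycle.**  `Q` finite, `v p₀ ∈ Q`, `X Y ∈ M`: there is `α : Q → M` — on the
`⟨v⟩`-orbit `{v^k p₀}` of `p₀` given by `α(v^k p₀) = X^k Y X^{-k}` (`0 ≤ k < ord v`), and `1` off it —
whose `v`-derivative `α(v t) X α(t)⁻¹ X⁻¹` is `[Y, X^{ord v}]` at the wrap point `t = v⁻¹ p₀` and `1`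
elsewhere — the local monodromy of the glued Heisenberg cover. [cite: MochizukiCombGC2007, Prop 1.2 proof p.9] -/
theorem exists_orbitCocycle [Finite Q] [DecidableEq Q] (v p₀ : Q) (X Y : M) :
    ∃ α : Q → M, ∀ t : Q,
      α (v * t) * X * (α t)⁻¹ * X⁻¹ =
        if t = v⁻¹ * p₀ then Y * X ^ orderOf v * Y⁻¹ * (X ^ orderOf v)⁻¹ else 1 := by
  have hv : IsOfFinOrder v := isOfFinOrder_of_finite v
  set L := orderOf v with hL
  have hLpos : 0 < L := hv.orderOf_pos
  let e := finEquivZPowers hv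
  -- discrete logarithm on `⟨v⟩`
  let lg : ∀ d : Q, d ∈ Subgroup.zpowers v → ℕ := fun d hd => (e.symm ⟨d, hd⟩ : ℕ)
  have hlg_lt : ∀ d hd, lg d hd < L := fun d hd => (e.symm ⟨d, hd⟩).isLt
  have hlg_pow : ∀ d hd, v ^ lg d hd = d := fun d hd => pow_finEquivZPowers_symm_apply hv ⟨d, hd⟩
  have hlg_of_pow : ∀ (n : ℕ) (hd : v ^ n ∈ Subgroup.zpowers v), lg (v ^ n) hd = n % L := by
    intro n hd
    have heq : (⟨v ^ n, hd⟩ : Subgroup.zpowers v) = ⟨v ^ n, ⟨n, by simp⟩⟩ := Subtype.ext rfl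
    change ((e.symm ⟨v ^ n, hd⟩ : Fin L) : ℕ) = n % L
    rw [heq]
    exact congrArg Fin.val (finEquivZPowers_symm_apply hv n)
  have hlg_congr : ∀ d₁ d₂ hd₁ hd₂, d₁ = d₂ → lg d₁ hd₁ = lg d₂ hd₂ := by
    rintro d₁ d₂ hd₁ hd₂ rfl; rfl
  let α : Q → M := fun t =>
    if hd : t * p₀⁻¹ ∈ Subgroup.zpowers v then
      X ^ lg (t * p₀⁻¹) hd * Y * (X ^ lg (t * p₀⁻¹) hd)⁻¹ else 1
  have hα_mem : ∀ t (hd : t * p₀⁻¹ ∈ Subgroup.zpowers v),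
      α t = X ^ lg (t * p₀⁻¹) hd * Y * (X ^ lg (t * p₀⁻¹) hd)⁻¹ := fun t hd => dif_pos hd
  have hα_not : ∀ t, t * p₀⁻¹ ∉ Subgroup.zpowers v → α t = 1 := fun t hd => dif_neg hd
  refine ⟨α, fun t => ?_⟩
  by_cases hd : t * p₀⁻¹ ∈ Subgroup.zpowers v
  · -- on the orbit: `t p₀⁻¹ = v^k`
    set k := lg (t * p₀⁻¹) hd with hk
    have hkL : k < L := hlg_lt _ hd
    have hvk : v ^ k = t * p₀⁻¹ := hlg_pow _ hd
    have hvt : v * t * p₀⁻¹ = v ^ (k + 1) := by rw [pow_succ', hvk, mul_assoc]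
    have hd' : v * t * p₀⁻¹ ∈ Subgroup.zpowers v := by rw [hvt]; exact ⟨k + 1, zpow_natCast v _⟩
    have hlg' : lg (v * t * p₀⁻¹) hd' = (k + 1) % L := by
      rw [hlg_congr _ _ hd' (hvt ▸ hd') hvt, hlg_of_pow]
    rw [hα_mem (v * t) hd', hlg', hα_mem t hd, ← hk]
    by_cases hwrap : k + 1 = L
    · -- the wrap point `t = v⁻¹ p₀`
      have h1 : v * t * p₀⁻¹ = 1 := by rw [hvt, hwrap, hL, pow_orderOf_eq_one]
      have ht : t = v⁻¹ * p₀ := by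
        rw [eq_inv_mul_iff_mul_eq]
        exact mul_inv_eq_one.mp h1
      rw [if_pos ht, hwrap, Nat.mod_self, pow_zero, inv_one, mul_one, one_mul, ← hwrap]
      simp only [mul_inv_rev, inv_inv, pow_succ]
      group
    · -- a generic point of the orbit
      have hlt : k + 1 < L := lt_of_le_of_ne hkL hwrap
      have hne : t ≠ v⁻¹ * p₀ := by
        intro ht
        have h1 : v ^ (k + 1) = 1 := by
          rw [← hvt, ht, ← mul_assoc, mul_inv_cancel, one_mul, mul_inv_cancel]
        have h2 : L ∣ k + 1 := hL ▸ orderOf_dvd_of_pow_eq_one h1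
        exact absurd (Nat.le_of_dvd (Nat.succ_pos k) h2) (not_le.mpr hlt)
      rw [if_neg hne, Nat.mod_eq_of_lt hlt]
      simp only [mul_inv_rev, inv_inv, pow_succ]
      group
  · -- off the orbit
    have hd' : v * t * p₀⁻¹ ∉ Subgroup.zpowers v := fun h => hd (by
      have h2 := Subgroup.mul_mem _ (Subgroup.inv_mem _ (Subgroup.mem_zpowers v)) h
      rwa [mul_assoc, inv_mul_cancel_left] at h2)
    have hne : t ≠ v⁻¹ * p₀ := by
      rintro rfl
      exact hd (by rw [mul_assoc, mul_inv_cancel, mul_one]; exact Subgroup.inv_mem _ (Subgroup.mem_zpowers v))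
    rw [hα_not _ hd', hα_not _ hd, if_neg hne, inv_one, mul_one, one_mul, mul_inv_cancel]

/-- **Powers of a Heisenberg-type triple**: if `X Y X⁻¹ Y⁻¹ = Z` with `Z` central then
`X^t Y^s = Z^{st} Y^s X^t` (Heisenberg group relations). [cite: MochizukiSemiAnbd2006, Ex. 2.10 p.31] -/
theorem pow_mul_pow_eq_of_comm_eq_central {X Y Z : M} (h : X * Y * X⁻¹ * Y⁻¹ = Z)
    (hZ : Z ∈ Subgroup.center M) (s t : ℕ) :
    X ^ t * Y ^ s = Z ^ (s * t) * Y ^ s * X ^ t := by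
  have hc : ∀ (n : ℕ) (g : M), g * Z ^ n = Z ^ n * g := fun n g =>
    Subgroup.mem_center_iff.mp (Subgroup.pow_mem _ hZ n) g
  have hc1 : ∀ g : M, g * Z = Z * g := fun g => Subgroup.mem_center_iff.mp hZ g
  have hXY : X * Y = Z * Y * X := by
    rw [← h]; group
  have h1 : ∀ t : ℕ, X ^ t * Y = Z ^ t * Y * X ^ t := by
    intro t
    induction t with
    | zero => simp
    | succ t ih =>
      calc X ^ (t + 1) * Y = X ^ t * (X * Y) := by rw [pow_succ, mul_assoc]
        _ = X ^ t * (Z * Y * X) := by rw [hXY]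
        _ = (X ^ t * Z) * Y * X := by simp only [mul_assoc]
        _ = (Z * X ^ t) * Y * X := by rw [hc1 (X ^ t)]
        _ = Z * (X ^ t * Y) * X := by simp only [mul_assoc]
        _ = Z * (Z ^ t * Y * X ^ t) * X := by rw [ih]
        _ = Z ^ (t + 1) * Y * X ^ (t + 1) := by rw [pow_succ' Z, pow_succ X]; simp only [mul_assoc]
  induction s with
  | zero => rw [pow_zero, zero_mul, pow_zero, one_mul, mul_one, one_mul]
  | succ s ih =>
    calc X ^ t * Y ^ (s + 1) = (X ^ t * Y ^ s) * Y := by rw [pow_succ, mul_assoc]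
      _ = Z ^ (s * t) * Y ^ s * X ^ t * Y := by rw [ih]
      _ = Z ^ (s * t) * Y ^ s * (X ^ t * Y) := by simp only [mul_assoc]
      _ = Z ^ (s * t) * Y ^ s * (Z ^ t * Y * X ^ t) := by rw [h1 t]
      _ = Z ^ (s * t) * (Y ^ s * Z ^ t) * Y * X ^ t := by simp only [mul_assoc]
      _ = Z ^ (s * t) * (Z ^ t * Y ^ s) * Y * X ^ t := by rw [hc t (Y ^ s)]
      _ = Z ^ ((s + 1) * t) * Y ^ (s + 1) * X ^ t := by
          rw [Nat.succ_mul, pow_add, pow_succ]; simp only [mul_assoc]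

/-- `Y^s X^t Y^{-s} X^{-t} = Z^{-st}` for a Heisenberg-type triple with central `Z`. [cite: MochizukiSemiAnbd2006, Ex. 2.10 p.31] -/
theorem pow_comm_pow_eq_of_comm_eq_central {X Y Z : M} (h : X * Y * X⁻¹ * Y⁻¹ = Z)
    (hZ : Z ∈ Subgroup.center M) (s t : ℕ) :
    Y ^ s * X ^ t * (Y ^ s)⁻¹ * (X ^ t)⁻¹ = (Z ^ (s * t))⁻¹ := by
  have h1 : X ^ t * Y ^ s * (X ^ t)⁻¹ * (Y ^ s)⁻¹ = Z ^ (s * t) := by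
    rw [pow_mul_pow_eq_of_comm_eq_central h hZ s t]; group
  rw [← h1]; group

end NodeTwist

/-! ### Ordered products over `List.finRange`: peeling the first and the last factor -/

section Lists

variable {P : Type*} [Monoid P]

/-- A `finRange` product all of whose factors but the one at `i₀` are `1` equals that factor.
[cite: LyndonSchupp2001, I.3 Prop 3.8] -/
theorem prod_map_finRange_ite_eq {n : ℕ} (i₀ : Fin n) (F : Fin n → P) :
    ((List.finRange n).map fun i : Fin n => if i = i₀ then F i else 1).prod = F i₀ := by
  classical
  rw [List.prod_map_eq_pow_single i₀ _ (fun i hi _ => if_neg hi),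
    List.count_eq_one_of_mem (List.nodup_finRange n) (List.mem_finRange i₀), pow_one, if_pos rfl]

/-- **Peeling the first factor of a truncated `finRange` product**: for `1 ≤ t`,
`∏_{i<t} F i = F 0 · ∏_{1 ≤ i < t} F i` (products padded by `1`). [cite: LyndonSchupp2001, I.3 Prop 3.8] -/
theorem prod_map_finRange_lt_eq_first_mul {n : ℕ} (hn : 0 < n) {t : ℕ} (ht : 1 ≤ t) (F : Fin n → P) :
    ((List.finRange n).map fun i : Fin n => if (i : ℕ) < t then F i else 1).prod =
      F ⟨0, hn⟩ * ((List.finRange n).map fun i : Fin n =>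
        if 1 ≤ (i : ℕ) then (if (i : ℕ) < t then F i else 1) else 1).prod := by
  rw [prod_map_finRange_split n 1 (fun i : Fin n => if (i : ℕ) < t then F i else 1)]
  congr 1
  rw [← prod_map_finRange_ite_eq ⟨0, hn⟩ F]
  congr 1
  refine List.map_congr_left fun i _ => ?_
  by_cases hi : i = ⟨0, hn⟩
  · subst hi
    rw [if_pos (show ((⟨0, hn⟩ : Fin n) : ℕ) < 1 from Nat.one_pos), if_pos (show ((⟨0, hn⟩ : Fin n) : ℕ) < t from ht), if_pos rfl]
  · have hi' : ¬ (i : ℕ) < 1 := fun h => hi (Fin.ext (Nat.lt_one_iff.mp h))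
    rw [if_neg hi', if_neg hi]

/-- **First · middle · last**: for `2 ≤ n`, `∏_{i<n} F i = F 0 · (∏_{1 ≤ i < n−1} F i) · F (n−1)`
(the middle product padded by `1`). [cite: LyndonSchupp2001, I.3 Prop 3.8] -/
theorem prod_map_finRange_eq_first_mul_mid_mul_last {n : ℕ} (hn : 2 ≤ n) (F : Fin n → P) :
    ((List.finRange n).map F).prod =
      F ⟨0, by omega⟩ * ((List.finRange n).map fun i : Fin n =>
        if 1 ≤ (i : ℕ) then (if (i : ℕ) < n - 1 then F i else 1) else 1).prod * F ⟨n - 1, by omega⟩ := by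
  have h0 : ((List.finRange n).map F).prod =
      ((List.finRange n).map fun i : Fin n => if (i : ℕ) < n then F i else 1).prod :=
    congrArg List.prod (List.map_congr_left fun i _ => by rw [if_pos i.isLt])
  rw [h0, prod_map_finRange_lt_eq_first_mul (by omega) (by omega) F, mul_assoc]
  congr 1
  rw [prod_map_finRange_split n (n - 1)]
  congr 1
  · refine congrArg List.prod (List.map_congr_left fun i _ => ?_)
    by_cases h1 : (i : ℕ) < n - 1
    · rw [if_pos h1]
      by_cases h2 : 1 ≤ (i : ℕ)
      · rw [if_pos h2, if_pos h2, if_pos i.isLt, if_pos h1]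
      · rw [if_neg h2, if_neg h2]
    · rw [if_neg h1]
      by_cases h2 : 1 ≤ (i : ℕ)
      · rw [if_pos h2, if_neg h1]
      · rw [if_neg h2]
  · rw [← prod_map_finRange_ite_eq ⟨n - 1, by omega⟩ F]
    refine congrArg List.prod (List.map_congr_left fun i _ => ?_)
    by_cases hi : i = ⟨n - 1, by omega⟩
    · subst hi
      rw [if_pos (le_refl _), if_pos (show 1 ≤ n - 1 by omega), if_pos (show n - 1 < n by omega), if_pos rfl]
    · have hi' : ¬ n - 1 ≤ (i : ℕ) := fun h => hi (Fin.ext (by have := i.isLt; simp; omega))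
      rw [if_neg hi', if_neg hi]

end Lists

end Literature.GroupTheory.CombinatorialGroupTheory
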